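import Summits.BirchSwinnertonDyer.BirchSwinnertonDyer.Theorems.PrintCFramBottomClassIndexLawFiveLeFlipRungMatrixFactorisation
import HarnessLib

/-!
# Crux `PrintCFram.BottomClassIndexLawFiveLe` (stmt-BirchSwinnertonDyer-20372), line `eisenstein-resource-bdp-line`:
# THE 2-ADIC FLIPPED-CUSP RUNG, typing item T6b — THE MATRIX FACTORISATIONS AT `2`:
# `τ_j · W = γ_j · T_j` with `γ_j ∈ Γ₀(4M′)`, `δ(γ_j) = 8 + M′j`, for `W = [[64a, b],[64M′, 64]]`, `64a − M′b = 1`, `j` odd; and the even translates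
# (cell `bsd-print-cfram`, width seat `bsd-line-cfram-p1-w7` g8; THEOREMS ONLY, `--supports` 20372 `--as helper`; BSD is not proved by any of this)

HONEST FRAMING. Nothing here is a statement about BSD, a curve or a modular form: this is the `2 × 2` integer algebra behind the 2-adic flipped-cusp
rung (crux notes `Lines/eisenstein-resource-bdp-line-w7g8-T6.md` §1a–§1b; glue `FlipRung.seedOffExc_of_flipRung_of_flipRungTwo_of_badOdd`,
file `…FlipRungTwoSupply`). It is w2 g14's T2 (`…FlipRungMatrixFactorisation`, `q` odd, `q ∤ M`) at the prime `2`, where the level `4M′` already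
contains `4`: the flip matrix is `W = [[64a, b],[64M′, 64]]` with `64a − M′b = 1` (`M′` ODD; determinant `64`), the class cut is by translates
`τ_j = [[1, j/8],[0, 1]]`, and for ODD `j`

    [[8, j],[0, 8]] · W = γ_j · [[64, −8j],[0, 64]],   γ_j = [[8a + jM′, c + j + aj],[8M′, 8 + M′j]] ∈ Γ₀(4M′),  det γ_j = 1,  b + M′j² = 8c

(the left factor is `8·τ_j`, the right factor is `8·[[8, −j],[0, 8]]`, i.e. `T_j : z ↦ z − j/8`); the lower-right entry `d_j = 8 + M′j` is
`≡ 8 (mod M′)` and `≡ M′j (mod 8)` — the two residues that make the half-integral multiplier `ψ(d_j)[ε_{d_j}⁻¹(8M′/d_j)]^{2k+1}` a function of `j mod 8`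
(T6a/T6c). The EVEN translates factor through upper-triangular maps of `z ↦ 64z + t`, `z ↦ 16z + t/2`, `z ↦ 4z + t/4` (§4), which is why their
contribution to `(P_c F)|W` has period `1/4`.

* §1 arithmetic of `64a − M′b = 1`: `M′` odd, `b` odd, `M′b ≡ −1 (mod 64)`, and for odd `j`: `8 ∣ b + M′j²` (the integrality of `γ_j`).
* §2 `translate_mul_W2_eq` (given the witness `b + M′j² = 8c`), `det_gammaTwo_eq_one`, the rational form `translate_mul_W2_eq_rat`, the `map` form.
* §3 `exists_gamma0_translate_mul_W2_eq` — packaged in `SL(2, ℤ)` / `CongruenceSubgroup.Gamma0 (4M′)` currency with the entries of the bottom row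
  displayed (`8M′`, `8 + M′j`).
* §4 the even translates: `W = [[a, ·],[M′, ·]]·[[64, t],[0, 1]]`, `[[2,1],[0,2]]·W = [[2a+M′, ·],[2M′, ·]]·[[64, 2],[0, 4]]`,
  `[[4, j₁],[0, 4]]·W = [[4a + j₁M′, ·],[4M′, ·]]·[[64, 4t],[0, 16]]` (each left factor of determinant `1`; the last one in `Γ₀(4M′)`).
* §5 the data exist: `M′` odd ⟹ `∃ a b, 64a − M′b = 1`.

beyond-print theorem: NO. References: [Shimura1973, Prop. 1.3–1.5]; [AtkinLehner1970, §6]; crux notes w7g8-T6 §1, lead-g14 §2.1; T2 file.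
-/

set_option autoImplicit false
-- summit-side namespace `Summit.BirchSwinnertonDyer.BirchSwinnertonDyer.…` (single-conjunct summit, D-0017 layout)
set_option linter.dupNamespace false

namespace Summit.BirchSwinnertonDyer.BirchSwinnertonDyer.Theorems.PrintCFram.FlipRung

open Matrix
open scoped MatrixGroups

/-! ## §1 Arithmetic of the data `64a − M′b = 1` -/

/-- From `64a − M′b = 1`: `M′·b ≡ −1 (mod 64)`. [folklore] -/
theorem mul_modEq_neg_one_of_det_two {M a b : ℤ} (hdet : 64 * a - M * b = 1) : M * b ≡ -1 [ZMOD 64] := by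
  refine Int.modEq_iff_dvd.mpr ⟨-a, ?_⟩
  linear_combination hdet

/-- From `64a − M′b = 1`: `M′` is odd. [folklore] -/
theorem odd_level_of_det_two {M a b : ℤ} (hdet : 64 * a - M * b = 1) : Odd M := by
  rcases Int.even_or_odd M with ⟨r, hr⟩ | hM
  · exfalso
    have h2 : (2 : ℤ) ∣ 1 := ⟨32 * a - r * b, by linear_combination -hdet - b * hr⟩
    omega
  · exact hM

/-- From `64a − M′b = 1`: `b` is odd. [folklore] -/
theorem odd_b_of_det_two {M a b : ℤ} (hdet : 64 * a - M * b = 1) : Odd b := by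
  rcases Int.even_or_odd b with ⟨r, hr⟩ | hb
  · exfalso
    have h2 : (2 : ℤ) ∣ 1 := ⟨32 * a - M * r, by linear_combination -hdet - M * hr⟩
    omega
  · exact hb

/-- **Integrality of `γ_j`: `8 ∣ b + M′j²` for odd `j`** (`M′b ≡ −1`, `M′² ≡ j² ≡ 1 (mod 8)`). [folklore] -/
theorem eight_dvd_b_add_mul_sq {M a b j : ℤ} (hdet : 64 * a - M * b = 1) (hj : Odd j) : (8 : ℤ) ∣ b + M * j ^ 2 := by
  have hM : Odd M := odd_level_of_det_two hdet
  obtain ⟨u, hu⟩ := eight_dvd_sq_sub_one_of_odd hj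
  obtain ⟨v, hv⟩ := eight_dvd_sq_sub_one_of_odd hM
  -- `M·(b + M j²) = (M b + 1) + M²(j² − 1) + (M² − 1) = 64a + 8(…)`
  have hmul : (8 : ℤ) ∣ M * (b + M * j ^ 2) :=
    ⟨8 * a + M ^ 2 * u + v, by linear_combination -hdet + M ^ 2 * hu + hv⟩
  have hcop : IsCoprime (8 : ℤ) M := by
    have h2 : IsCoprime (2 : ℤ) M := by
      obtain ⟨r, hr⟩ := hM
      exact ⟨-r, 1, by linear_combination hr⟩
    have h8 : IsCoprime ((2 : ℤ) ^ 3) M := h2.pow_left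
    norm_num at h8
    exact h8
  exact hcop.dvd_of_dvd_mul_left hmul

/-! ## §2 The factorisation for a given witness `c` -/

/-- **`[[8, j],[0, 8]] · W = γ_j · [[64, −8j],[0, 64]]` with `γ_j` EXPLICIT.** For `64a − M′b = 1` and a witness `b + M′j² = 8c` put
`γ_j := [[8a + jM′, c + j + aj],[8M′, 8 + M′j]]`; then the identity holds (`[[8, j],[0,8]] = 8·τ_j`, `[[64, −8j],[0,64]] = 8·[[8, −j],[0, 8]]`).
[cite: Shimura1973, Prop. 1.5] [cite: AtkinLehner1970, §6] -/
theorem translate_mul_W2_eq {M a b j c : ℤ} (hc : b + M * j ^ 2 = 8 * c) :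
    !![(8 : ℤ), j; 0, 8] * !![64 * a, b; 64 * M, 64] =
      !![8 * a + j * M, c + j + a * j; 8 * M, 8 + M * j] * !![64, -8 * j; 0, 64] := by
  rw [Matrix.mul_fin_two, Matrix.mul_fin_two]
  have e11 : (8 : ℤ) * (64 * a) + j * (64 * M) = (8 * a + j * M) * 64 + (c + j + a * j) * 0 := by ring
  have e12 : (8 : ℤ) * b + j * 64 = (8 * a + j * M) * (-8 * j) + (c + j + a * j) * 64 := by
    linear_combination 8 * hc
  have e21 : (0 : ℤ) * (64 * a) + 8 * (64 * M) = 8 * M * 64 + (8 + M * j) * 0 := by ring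
  have e22 : (0 : ℤ) * b + 8 * 64 = 8 * M * (-8 * j) + (8 + M * j) * 64 := by ring
  rw [e11, e12, e21, e22]

/-- `det γ_j = 1`. [folklore] -/
theorem det_gammaTwo_eq_one {M a b j c : ℤ} (hdet : 64 * a - M * b = 1) (hc : b + M * j ^ 2 = 8 * c) :
    Matrix.det !![8 * a + j * M, c + j + a * j; 8 * M, 8 + M * j] = 1 := by
  rw [Matrix.det_fin_two_of]
  linear_combination hdet + M * hc

/-- The rational form `τ_j · W = γ_j · [[8, −j],[0, 8]]`, `τ_j = [[1, j/8],[0, 1]]` (so `f|τ_jW = (f|γ_j)(z − j/8)`). [cite: Shimura1973, Prop. 1.5] -/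
theorem translate_mul_W2_eq_rat {M a b j c : ℤ} (hc : b + M * j ^ 2 = 8 * c) :
    !![(1 : ℚ), (j : ℚ) / 8; 0, 1] * !![(64 : ℚ) * a, (b : ℚ); 64 * M, 64] =
      !![(8 : ℚ) * a + j * M, (c : ℚ) + j + a * j; 8 * M, 8 + M * j] * !![(8 : ℚ), -(j : ℚ); 0, 8] := by
  have hcQ : (b : ℚ) + M * j ^ 2 = 8 * c := by exact_mod_cast hc
  rw [Matrix.mul_fin_two, Matrix.mul_fin_two]
  have e11 : (1 : ℚ) * (64 * a) + (j : ℚ) / 8 * (64 * M) = (8 * a + j * M) * 8 + ((c : ℚ) + j + a * j) * 0 := by ring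
  have e12 : (1 : ℚ) * (b : ℚ) + (j : ℚ) / 8 * 64 = (8 * a + j * M) * (-(j : ℚ)) + ((c : ℚ) + j + a * j) * 8 := by
    linear_combination hcQ
  have e21 : (0 : ℚ) * (64 * a) + 1 * (64 * M) = 8 * M * 8 + (8 + M * j) * 0 := by ring
  have e22 : (0 : ℚ) * (b : ℚ) + 1 * 64 = 8 * M * (-(j : ℚ)) + (8 + M * j) * 8 := by ring
  rw [e11, e12, e21, e22]

/-- The factorisation read in any commutative ring (entrywise cast). [folklore] -/
theorem translate_mul_W2_eq_map {R : Type*} [CommRing R] {M a b j c : ℤ} (hc : b + M * j ^ 2 = 8 * c) :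
    (!![(8 : ℤ), j; 0, 8] : Matrix (Fin 2) (Fin 2) ℤ).map (Int.castRingHom R) *
        (!![64 * a, b; 64 * M, 64] : Matrix (Fin 2) (Fin 2) ℤ).map (Int.castRingHom R) =
      (!![8 * a + j * M, c + j + a * j; 8 * M, 8 + M * j] : Matrix (Fin 2) (Fin 2) ℤ).map (Int.castRingHom R) *
        (!![64, -8 * j; 0, 64] : Matrix (Fin 2) (Fin 2) ℤ).map (Int.castRingHom R) := by
  rw [← Matrix.map_mul, ← Matrix.map_mul, translate_mul_W2_eq hc]

/-! ## §3 Packaged: `γ_j ∈ Γ₀(4M′)` with its bottom row displayed -/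

/-- **THE MATRIX FACTORISATION AT `2` (T6b).** For `M′` odd, `64a − M′b = 1` (so `W = [[64a, b],[64M′, 64]]` has determinant `64`) and every ODD `j`
there is `γ ∈ Γ₀(4M′)` with bottom row `(8M′, 8 + M′j)` — hence `δ ≡ 8 (mod M′)` and `δ ≡ M′j (mod 8)` — such that
`[[8, j],[0, 8]]·W = γ·[[64, −8j],[0, 64]]`, i.e. `τ_j·W = γ·[[8, −j],[0, 8]]`. [cite: Shimura1973, Prop. 1.5] [cite: AtkinLehner1970, §6] -/
theorem exists_gamma0_translate_mul_W2_eq {M : ℕ} {a b : ℤ} (hdet : 64 * a - (M : ℤ) * b = 1) {j : ℤ} (hj : Odd j) :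
    ∃ γ : SL(2, ℤ), γ ∈ CongruenceSubgroup.Gamma0 (4 * M) ∧ (γ 1 0 : ℤ) = 8 * (M : ℤ) ∧ (γ 1 1 : ℤ) = 8 + (M : ℤ) * j ∧
      ((γ 1 1 : ℤ) : ZMod M) = 8 ∧ ((γ 0 0 : ℤ) : ZMod M) = 8 * (a : ZMod M) ∧
      !![(8 : ℤ), j; 0, 8] * !![64 * a, b; 64 * (M : ℤ), 64] = (γ : Matrix (Fin 2) (Fin 2) ℤ) * !![64, -8 * j; 0, 64] := by
  obtain ⟨c, hc⟩ := eight_dvd_b_add_mul_sq hdet hj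
  refine ⟨⟨!![8 * a + j * M, c + j + a * j; 8 * (M : ℤ), 8 + (M : ℤ) * j], det_gammaTwo_eq_one hdet hc⟩, ?_, ?_, ?_, ?_, ?_, ?_⟩
  · rw [CongruenceSubgroup.Gamma0_mem]
    simp only [of_apply, cons_val', cons_val_zero, cons_val_one, Int.cast_mul, Int.cast_ofNat, Int.cast_natCast]
    rw [show ((8 : ZMod (4 * M)) * (M : ZMod (4 * M))) = 2 * ((4 * M : ℕ) : ZMod (4 * M)) by push_cast; ring, ZMod.natCast_self,
      mul_zero]
  · simp
  · simp
  · simp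
  · simp
  · exact translate_mul_W2_eq hc

/-! ## §4 The even translates: upper-triangular factors scaling `z` by `64`, `16`, `4` (period `1/4` of the even part) -/

/-- `W = [[a, b − at],[M′, 64 − M′t]] · [[64, t],[0, 1]]` for every `t` (the translate `j = 0`: the cusp `a/M′`). [folklore] -/
theorem W2_eq_cusp_mul (M a b t : ℤ) :
    !![64 * a, b; 64 * M, 64] = !![a, b - a * t; M, 64 - M * t] * !![64, t; 0, 1] := by
  rw [Matrix.mul_fin_two]
  have e11 : (64 : ℤ) * a = a * 64 + (b - a * t) * 0 := by ring
  have e12 : b = a * t + (b - a * t) * 1 := by ring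
  have e21 : (64 : ℤ) * M = M * 64 + (64 - M * t) * 0 := by ring
  have e22 : (64 : ℤ) = M * t + (64 - M * t) * 1 := by ring
  rw [← e11, ← e12, ← e21, ← e22]

/-- Its left factor has determinant `1`. [folklore] -/
theorem det_cusp_eq_one {M a b : ℤ} (hdet : 64 * a - M * b = 1) (t : ℤ) :
    Matrix.det !![a, b - a * t; M, 64 - M * t] = 1 := by
  rw [Matrix.det_fin_two_of]
  linear_combination hdet

/-- `[[2, 1],[0, 2]] · W = [[2a + M′, B],[2M′, 32 − M′]] · [[64, 2],[0, 4]]` with `2B = b + 32 − 2a − M′` (the translate `j = 4`, i.e. `z + 1/2`;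
`b` and `M′` are odd so `B ∈ ℤ`). [folklore] -/
theorem translateHalf_mul_W2_eq {M a b B : ℤ} (hB : b + 32 - 2 * a - M = 2 * B) :
    !![(2 : ℤ), 1; 0, 2] * !![64 * a, b; 64 * M, 64] = !![2 * a + M, B; 2 * M, 32 - M] * !![64, 2; 0, 4] := by
  rw [Matrix.mul_fin_two, Matrix.mul_fin_two]
  have e11 : (2 : ℤ) * (64 * a) + 1 * (64 * M) = (2 * a + M) * 64 + B * 0 := by ring
  have e12 : (2 : ℤ) * b + 1 * 64 = (2 * a + M) * 2 + B * 4 := by linear_combination 2 * hB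
  have e21 : (0 : ℤ) * (64 * a) + 2 * (64 * M) = 2 * M * 64 + (32 - M) * 0 := by ring
  have e22 : (0 : ℤ) * b + 2 * 64 = 2 * M * 2 + (32 - M) * 4 := by ring
  rw [e11, e12, e21, e22]

/-- Its left factor has determinant `1`. [folklore] -/
theorem det_translateHalf_eq_one {M a b B : ℤ} (hdet : 64 * a - M * b = 1) (hB : b + 32 - 2 * a - M = 2 * B) :
    Matrix.det !![2 * a + M, B; 2 * M, 32 - M] = 1 := by
  rw [Matrix.det_fin_two_of]
  linear_combination hdet + M * hB

/-- `[[4, j₁],[0, 4]] · W = [[4a + j₁M′, B],[4M′, 16 − M′t]] · [[64, 4t],[0, 16]]` with `4B = b + 16j₁ − t(4a + j₁M′)` (the translates `z + j₁/4`,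
`j₁` odd; the left factor lies in `Γ₀(4M′)`). [folklore] -/
theorem translateQuarter_mul_W2_eq {M a b j₁ t B : ℤ} (hB : b + 16 * j₁ - t * (4 * a + j₁ * M) = 4 * B) :
    !![(4 : ℤ), j₁; 0, 4] * !![64 * a, b; 64 * M, 64] = !![4 * a + j₁ * M, B; 4 * M, 16 - M * t] * !![64, 4 * t; 0, 16] := by
  rw [Matrix.mul_fin_two, Matrix.mul_fin_two]
  have e11 : (4 : ℤ) * (64 * a) + j₁ * (64 * M) = (4 * a + j₁ * M) * 64 + B * 0 := by ring
  have e12 : (4 : ℤ) * b + j₁ * 64 = (4 * a + j₁ * M) * (4 * t) + B * 16 := by linear_combination 4 * hB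
  have e21 : (0 : ℤ) * (64 * a) + 4 * (64 * M) = 4 * M * 64 + (16 - M * t) * 0 := by ring
  have e22 : (0 : ℤ) * b + 4 * 64 = 4 * M * (4 * t) + (16 - M * t) * 16 := by ring
  rw [e11, e12, e21, e22]

/-- Its left factor has determinant `1`. [folklore] -/
theorem det_translateQuarter_eq_one {M a b j₁ t B : ℤ} (hdet : 64 * a - M * b = 1)
    (hB : b + 16 * j₁ - t * (4 * a + j₁ * M) = 4 * B) :
    Matrix.det !![4 * a + j₁ * M, B; 4 * M, 16 - M * t] = 1 := by
  rw [Matrix.det_fin_two_of]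
  linear_combination hdet + M * hB

/-- A witness for the quarter translates: with `t := j₁·M′·b` the number `b + 16j₁ − t(4a + j₁M′)` is divisible by `4` (`(j₁M′)² ≡ 1 (mod 8)`,
`M′b = 64a − 1`). [folklore] -/
theorem four_dvd_quarter_witness {M a b j₁ : ℤ} (hdet : 64 * a - M * b = 1) (hj₁ : Odd j₁) :
    (4 : ℤ) ∣ b + 16 * j₁ - (j₁ * M * b) * (4 * a + j₁ * M) := by
  have hM : Odd M := odd_level_of_det_two hdet
  obtain ⟨u, hu⟩ := eight_dvd_sq_sub_one_of_odd (hj₁.mul hM)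
  refine ⟨4 * j₁ - 64 * a ^ 2 * j₁ + a * j₁ - 2 * b * u, ?_⟩
  linear_combination 4 * a * j₁ * hdet - b * hu

/-! ## §5 The data exist -/

/-- For `M′` odd there are `a, b` with `64a − M′b = 1`. [folklore] -/
theorem exists_det_two {M : ℤ} (hM : Odd M) : ∃ a b : ℤ, 64 * a - M * b = 1 := by
  have h2 : IsCoprime (2 : ℤ) M := by
    obtain ⟨r, hr⟩ := hM
    exact ⟨-r, 1, by linear_combination hr⟩
  obtain ⟨u, v, huv⟩ := h2.pow_left (m := 6)
  exact ⟨u, -v, by linear_combination huv⟩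

end Summit.BirchSwinnertonDyer.BirchSwinnertonDyer.Theorems.PrintCFram.FlipRung
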